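import Literature.Analysis.FluidPDE.ElgindiWkWords
import Literature.Analysis.FluidPDE.ElgindiBoundaryClassesZero
import HarnessLib

/-!
# `D_θ`-words in terms of the damped angular derivative: `D_θ^a = Σ_m c_{a,m}(θ)·A_γ^m`, `a ≤ 4`
([ElgindiGhoulMasmoudi2021] §1.7 / §9 Proposition 9.3)

Topic `Literature/Analysis/FluidPDE`. Support file (definitions with bodies and proved theorems, no
named facts) on the proof path of the named fact
`Literature.Analysis.FluidPDE.Elgindi.ElgindiGhoulMasmoudi2021_stabilityCore`
(`ElgindiStabilityDecomposition.lean`). T. M. Elgindi, T.-E. Ghoul, N. Masmoudi, Camb. J. Math. 9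
(2021) = arXiv:1910.14071, §1.7 (p. 6) and §9 Proposition 9.3 (p. 20).

With `s = sin 2θ`, `c = cos 2θ`, `q = γ − 1 + s` and `A = A_γ = (s/q)∂_θ`, on the open strip:
`D_θ f = qAf`, `D_θ²f = 2sc·Af + q²A²f`,
`D_θ³f = 4s(c² − s²)Af + 6scq·A²f + q³A³f`,
`D_θ⁴f = (8sc³ − 40s³c)Af + (16sqc² − 16s³q + 12s²c²)A²f + 12scq²A³f + q⁴A⁴f`.
Every coefficient carries a factor `s` or `q` (`s ≤ q ≤ γ ≤ 2` for `α ≤ 10`), which is the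
smallness used when all angular derivatives of a word fall on the `𝓦^{4,∞}` factor.
-/

noncomputable section

open MeasureTheory Set Function Real Filter
open _root_.Topology
open scoped ENNReal ContDiff

namespace Literature.Analysis.FluidPDE

namespace Elgindi

/-! ### Derivatives of `s`, `c`, `q` -/

/-- `q(θ) = γ − 1 + sin 2θ`. [folklore] -/
def qW (α θ : ℝ) : ℝ := gammaExp α - 1 + Real.sin (2 * θ)

/-- `(sin 2θ)′ = 2cos 2θ`. [folklore] -/
theorem hasDerivAt_sin2 (θ : ℝ) : HasDerivAt (fun θ : ℝ => Real.sin (2 * θ)) (2 * Real.cos (2 * θ)) θ := by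
  have h : HasDerivAt (fun θ : ℝ => Real.sin (2 * θ)) (Real.cos (2 * θ) * (2 * 1)) θ :=
    (Real.hasDerivAt_sin (2 * θ)).comp θ ((hasDerivAt_id θ).const_mul 2)
  convert h using 1; ring

/-- `(cos 2θ)′ = −2 sin 2θ`. [folklore] -/
theorem hasDerivAt_cos2 (θ : ℝ) : HasDerivAt (fun θ : ℝ => Real.cos (2 * θ)) (-2 * Real.sin (2 * θ)) θ := by
  have h : HasDerivAt (fun θ : ℝ => Real.cos (2 * θ)) (-Real.sin (2 * θ) * (2 * 1)) θ :=
    (Real.hasDerivAt_cos (2 * θ)).comp θ ((hasDerivAt_id θ).const_mul 2)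
  convert h using 1; ring

/-- `q′ = 2cos 2θ`. [folklore] -/
theorem hasDerivAt_qW (α θ : ℝ) : HasDerivAt (qW α) (2 * Real.cos (2 * θ)) θ := by
  unfold qW; simpa using (hasDerivAt_sin2 θ).const_add (gammaExp α - 1)

/-! ### `D_θ` of an angular coefficient times a strip-smooth function -/

/-- **`D_θ(μ(θ)g) = s·μ′·g + μ·D_θg`** on the strip, for `μ ∈ C^∞(ℝ)` and `g` smooth on the strip. [folklore] -/
theorem Dθ_coef_mul_strip {μ : ℝ → ℝ} (hμ : ContDiff ℝ ∞ μ) {g : ℝ → ℝ → ℝ} (hg : ContDiffOn ℝ ∞ (uncurry g) strip)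
    {p : ℝ × ℝ} (hp : p ∈ strip) :
    Dθ (fun z θ => μ θ * g z θ) p.1 p.2 = Real.sin (2 * p.2) * deriv μ p.2 * g p.1 p.2 + μ p.2 * Dθ g p.1 p.2 := by
  have hμ2 : ContDiffOn ℝ ∞ (uncurry fun (_ : ℝ) (θ : ℝ) => μ θ) strip := (hμ.comp contDiff_snd).contDiffOn
  rw [Dθ_eq_mul_dθ, dθ_mul_strip hμ2 hg p hp, Dθ_eq_mul_dθ]
  have e : dθ (fun (_ : ℝ) (θ : ℝ) => μ θ) p.1 p.2 = deriv μ p.2 := rfl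
  rw [e]; ring

/-- `D_θ(A^m f) = q·A^{m+1} f` on the strip. [cite: ElgindiGhoulMasmoudi2021, §1.7 (p. 6 of arXiv:1910.14071)] -/
theorem Dθ_iterate_angOpW {α : ℝ} (hα : 0 < α) (f : ℝ → ℝ → ℝ) (m : ℕ) {p : ℝ × ℝ} (hp : p ∈ strip) :
    Dθ ((angOpW α)^[m] f) p.1 p.2 = qW α p.2 * ((angOpW α)^[m + 1] f) p.1 p.2 := by
  rw [Function.iterate_succ_apply', Dθ_eq_mul_angOpW hα _ _ hp.2]; rfl

/-! ### The four identities -/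

section identities

variable {α : ℝ} (hα : 0 < α) {f : ℝ → ℝ → ℝ} (hf : ContDiffOn ℝ ∞ (uncurry f) strip)
include hα hf

/-- `A^m f` is smooth on the strip. [folklore] -/
theorem iterA_smooth (m : ℕ) : ContDiffOn ℝ ∞ (uncurry ((angOpW α)^[m] f)) strip := contDiffOn_iterate_angOpW_strip hα hf m

omit hf in
/-- **`D_θ f = q·Af`.** [cite: ElgindiGhoulMasmoudi2021, §1.7 (p. 6 of arXiv:1910.14071)] -/
theorem Dθ_one_eq {p : ℝ × ℝ} (hp : p ∈ strip) : Dθ f p.1 p.2 = qW α p.2 * (angOpW α f) p.1 p.2 := by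
  have := Dθ_iterate_angOpW hα f 0 hp; simpa using this

/-- **`D_θ²f = 2sc·Af + q²·A²f`.** [cite: ElgindiGhoulMasmoudi2021, §9 Proposition 9.3 (p. 20 of arXiv:1910.14071)] -/
theorem Dθ_two_eq {p : ℝ × ℝ} (hp : p ∈ strip) :
    (Dθ^[2] f) p.1 p.2 = 2 * Real.sin (2 * p.2) * Real.cos (2 * p.2) * (angOpW α f) p.1 p.2 +
      qW α p.2 ^ 2 * ((angOpW α)^[2] f) p.1 p.2 := by
  have s1 : ∀ r ∈ strip, Dθ f r.1 r.2 = qW α r.2 * (angOpW α f) r.1 r.2 := fun r hr => Dθ_one_eq hα hr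
  have hq : ContDiff ℝ ∞ (qW α) := by unfold qW; fun_prop
  have h1 := Dθ_iterate_angOpW hα f 1 hp
  simp only [Function.iterate_one] at h1
  rw [Function.iterate_succ_apply', Function.iterate_one, Dθ_eq_mul_dθ,
    dθ_congr (g := fun z θ => qW α θ * (angOpW α f) z θ) s1 hp, ← Dθ_eq_mul_dθ,
    Dθ_coef_mul_strip (μ := qW α) hq (contDiffOn_angOpW_strip hα hf) hp, (hasDerivAt_qW α p.2).deriv, h1]
  ring

/-- Smoothness of `μ(θ)·A^m f` on the strip. [folklore] -/
theorem coef_iterA_smooth {μ : ℝ → ℝ} (hμ : ContDiff ℝ ∞ μ) (m : ℕ) :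
    ContDiffOn ℝ ∞ (uncurry fun z θ => μ θ * ((angOpW α)^[m] f) z θ) strip :=
  ((hμ.comp contDiff_snd).contDiffOn.mul (iterA_smooth hα hf m)).congr fun _ _ => rfl

/-- **`D_θ(μ·A^m f) = sμ′·A^m f + μq·A^{m+1}f`** on the strip. [folklore] -/
theorem Dθ_coef_iterA {μ : ℝ → ℝ} (hμ : ContDiff ℝ ∞ μ) {μ' : ℝ} {p : ℝ × ℝ} (hp : p ∈ strip) (hμ' : HasDerivAt μ μ' p.2) (m : ℕ) :
    Dθ (fun z θ => μ θ * ((angOpW α)^[m] f) z θ) p.1 p.2 =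
      Real.sin (2 * p.2) * μ' * ((angOpW α)^[m] f) p.1 p.2 + μ p.2 * (qW α p.2 * ((angOpW α)^[m + 1] f) p.1 p.2) := by
  rw [Dθ_coef_mul_strip hμ (iterA_smooth hα hf m) hp, hμ'.deriv, Dθ_iterate_angOpW hα f m hp]

omit hα hf in
/-- `D_θ(u + v) = D_θu + D_θv` on the strip for strip-smooth `u, v`. [folklore] -/
theorem Dθ_add_strip {u v : ℝ → ℝ → ℝ} (hu : ContDiffOn ℝ ∞ (uncurry u) strip) (hv : ContDiffOn ℝ ∞ (uncurry v) strip)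
    {p : ℝ × ℝ} (hp : p ∈ strip) : Dθ (u + v) p.1 p.2 = Dθ u p.1 p.2 + Dθ v p.1 p.2 := by
  have h := iterate_Dθ_Dz_add (hu.of_le (WithTop.coe_le_coe.2 le_top : (1 : WithTop ℕ∞) ≤ ((⊤ : ℕ∞) : WithTop ℕ∞)))
    (hv.of_le (WithTop.coe_le_coe.2 le_top : (1 : WithTop ℕ∞) ≤ ((⊤ : ℕ∞) : WithTop ℕ∞))) (i := 1) (j := 0) (by norm_num) p hp
  simpa using h

/-- **`D_θ³f = (4sc² − 4s³)·Af + 6scq·A²f + q³·A³f`.** [cite: ElgindiGhoulMasmoudi2021, §9 Proposition 9.3 (p. 20 of arXiv:1910.14071)] -/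
theorem Dθ_three_eq {p : ℝ × ℝ} (hp : p ∈ strip) :
    (Dθ^[3] f) p.1 p.2 =
      (4 * Real.sin (2 * p.2) * Real.cos (2 * p.2) ^ 2 - 4 * Real.sin (2 * p.2) ^ 3) * (angOpW α f) p.1 p.2 +
        6 * Real.sin (2 * p.2) * Real.cos (2 * p.2) * qW α p.2 * ((angOpW α)^[2] f) p.1 p.2 +
        qW α p.2 ^ 3 * ((angOpW α)^[3] f) p.1 p.2 := by
  -- `D_θ²f = u + v` on the strip
  set u : ℝ → ℝ → ℝ := fun z θ => (2 * Real.sin (2 * θ) * Real.cos (2 * θ)) * ((angOpW α)^[1] f) z θ with hu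
  set v : ℝ → ℝ → ℝ := fun z θ => (qW α θ * qW α θ) * ((angOpW α)^[2] f) z θ with hv
  have hμu : ContDiff ℝ ∞ fun θ : ℝ => 2 * Real.sin (2 * θ) * Real.cos (2 * θ) := by fun_prop
  have hμv : ContDiff ℝ ∞ fun θ : ℝ => qW α θ * qW α θ := by unfold qW; fun_prop
  have s2 : ∀ r ∈ strip, (Dθ^[2] f) r.1 r.2 = (u + v) r.1 r.2 := fun r hr => by
    rw [Dθ_two_eq hα hf hr]; simp only [hu, hv, Pi.add_apply, Function.iterate_one]; ring
  have hdu : HasDerivAt (fun θ : ℝ => 2 * Real.sin (2 * θ) * Real.cos (2 * θ))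
      (2 * (2 * Real.cos (2 * p.2)) * Real.cos (2 * p.2) + 2 * Real.sin (2 * p.2) * (-2 * Real.sin (2 * p.2))) p.2 :=
    ((hasDerivAt_sin2 p.2).const_mul 2).mul (hasDerivAt_cos2 p.2)
  have hdv : HasDerivAt (fun θ : ℝ => qW α θ * qW α θ)
      (2 * Real.cos (2 * p.2) * qW α p.2 + qW α p.2 * (2 * Real.cos (2 * p.2))) p.2 :=
    (hasDerivAt_qW α p.2).mul (hasDerivAt_qW α p.2)
  rw [Function.iterate_succ_apply', Dθ_eq_mul_dθ, dθ_congr s2 hp, ← Dθ_eq_mul_dθ,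
    Dθ_add_strip (coef_iterA_smooth hα hf hμu 1) (coef_iterA_smooth hα hf hμv 2) hp,
    Dθ_coef_iterA hα hf hμu hp hdu 1, Dθ_coef_iterA hα hf hμv hp hdv 2]
  simp only [Function.iterate_one]
  ring

/-- **`D_θ⁴f = (8sc³ − 40s³c)·Af + (16sc²q − 16s³q + 12s²c²)·A²f + 12scq²·A³f + q⁴·A⁴f`.** [cite: ElgindiGhoulMasmoudi2021, §9 Proposition 9.3 (p. 20 of arXiv:1910.14071)] -/
theorem Dθ_four_eq {p : ℝ × ℝ} (hp : p ∈ strip) :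
    (Dθ^[4] f) p.1 p.2 =
      (8 * Real.sin (2 * p.2) * Real.cos (2 * p.2) ^ 3 - 40 * Real.sin (2 * p.2) ^ 3 * Real.cos (2 * p.2)) * (angOpW α f) p.1 p.2 +
        (16 * Real.sin (2 * p.2) * Real.cos (2 * p.2) ^ 2 * qW α p.2 - 16 * Real.sin (2 * p.2) ^ 3 * qW α p.2 +
          12 * Real.sin (2 * p.2) ^ 2 * Real.cos (2 * p.2) ^ 2) * ((angOpW α)^[2] f) p.1 p.2 +
        12 * Real.sin (2 * p.2) * Real.cos (2 * p.2) * qW α p.2 ^ 2 * ((angOpW α)^[3] f) p.1 p.2 +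
        qW α p.2 ^ 4 * ((angOpW α)^[4] f) p.1 p.2 := by
  set u : ℝ → ℝ → ℝ := fun z θ => (4 * Real.sin (2 * θ) * Real.cos (2 * θ) * Real.cos (2 * θ) -
    4 * Real.sin (2 * θ) * Real.sin (2 * θ) * Real.sin (2 * θ)) * ((angOpW α)^[1] f) z θ with hu
  set v : ℝ → ℝ → ℝ := fun z θ => (6 * Real.sin (2 * θ) * Real.cos (2 * θ) * qW α θ) * ((angOpW α)^[2] f) z θ with hv
  set w : ℝ → ℝ → ℝ := fun z θ => (qW α θ * qW α θ * qW α θ) * ((angOpW α)^[3] f) z θ with hw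
  have hμu : ContDiff ℝ ∞ fun θ : ℝ => 4 * Real.sin (2 * θ) * Real.cos (2 * θ) * Real.cos (2 * θ) -
      4 * Real.sin (2 * θ) * Real.sin (2 * θ) * Real.sin (2 * θ) := by fun_prop
  have hμv : ContDiff ℝ ∞ fun θ : ℝ => 6 * Real.sin (2 * θ) * Real.cos (2 * θ) * qW α θ := by unfold qW; fun_prop
  have hμw : ContDiff ℝ ∞ fun θ : ℝ => qW α θ * qW α θ * qW α θ := by unfold qW; fun_prop
  have s3 : ∀ r ∈ strip, (Dθ^[3] f) r.1 r.2 = (u + v + w) r.1 r.2 := fun r hr => by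
    rw [Dθ_three_eq hα hf hr]; simp only [hu, hv, hw, Pi.add_apply, Function.iterate_one]; ring
  have hdu : HasDerivAt (fun θ : ℝ => 4 * Real.sin (2 * θ) * Real.cos (2 * θ) * Real.cos (2 * θ) -
      4 * Real.sin (2 * θ) * Real.sin (2 * θ) * Real.sin (2 * θ))
      (((4 * (2 * Real.cos (2 * p.2)) * Real.cos (2 * p.2) + 4 * Real.sin (2 * p.2) * (-2 * Real.sin (2 * p.2))) * Real.cos (2 * p.2) +
          4 * Real.sin (2 * p.2) * Real.cos (2 * p.2) * (-2 * Real.sin (2 * p.2))) -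
        ((4 * (2 * Real.cos (2 * p.2)) * Real.sin (2 * p.2) + 4 * Real.sin (2 * p.2) * (2 * Real.cos (2 * p.2))) * Real.sin (2 * p.2) +
          4 * Real.sin (2 * p.2) * Real.sin (2 * p.2) * (2 * Real.cos (2 * p.2)))) p.2 :=
    ((((hasDerivAt_sin2 p.2).const_mul 4).mul (hasDerivAt_cos2 p.2)).mul (hasDerivAt_cos2 p.2)).sub
      ((((hasDerivAt_sin2 p.2).const_mul 4).mul (hasDerivAt_sin2 p.2)).mul (hasDerivAt_sin2 p.2))
  have hdv : HasDerivAt (fun θ : ℝ => 6 * Real.sin (2 * θ) * Real.cos (2 * θ) * qW α θ)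
      ((6 * (2 * Real.cos (2 * p.2)) * Real.cos (2 * p.2) + 6 * Real.sin (2 * p.2) * (-2 * Real.sin (2 * p.2))) * qW α p.2 +
        6 * Real.sin (2 * p.2) * Real.cos (2 * p.2) * (2 * Real.cos (2 * p.2))) p.2 :=
    (((hasDerivAt_sin2 p.2).const_mul 6).mul (hasDerivAt_cos2 p.2)).mul (hasDerivAt_qW α p.2)
  have hdw : HasDerivAt (fun θ : ℝ => qW α θ * qW α θ * qW α θ)
      ((2 * Real.cos (2 * p.2) * qW α p.2 + qW α p.2 * (2 * Real.cos (2 * p.2))) * qW α p.2 +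
        qW α p.2 * qW α p.2 * (2 * Real.cos (2 * p.2))) p.2 :=
    ((hasDerivAt_qW α p.2).mul (hasDerivAt_qW α p.2)).mul (hasDerivAt_qW α p.2)
  have huv : ContDiffOn ℝ ∞ (uncurry (u + v)) strip :=
    ((coef_iterA_smooth hα hf hμu 1).add (coef_iterA_smooth hα hf hμv 2)).congr fun _ _ => by simp only [hu, hv]; rfl
  rw [Function.iterate_succ_apply', Dθ_eq_mul_dθ, dθ_congr s3 hp, ← Dθ_eq_mul_dθ,
    Dθ_add_strip huv (coef_iterA_smooth hα hf hμw 3) hp,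
    Dθ_add_strip (coef_iterA_smooth hα hf hμu 1) (coef_iterA_smooth hα hf hμv 2) hp,
    Dθ_coef_iterA hα hf hμu hp hdu 1, Dθ_coef_iterA hα hf hμv hp hdv 2, Dθ_coef_iterA hα hf hμw hp hdw 3]
  simp only [Function.iterate_one]
  ring

end identities

end Elgindi

end Literature.Analysis.FluidPDE
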